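import Mathlib
import Literature.NumberTheory.LFunctions.WeilExplicit
import Literature.NumberTheory.LFunctions.WeilMarkovQuadratic
import Summits.RiemannHypothesis.RiemannHypothesis.Theses.GroundBarta

/-!
# Sketch — crux-ideate stmt-RiemannHypothesis-18807 (`GroundBarta.EvenWinsBeyondArch`), ideator 1, round 1

Idea `hankel-channel`: the parity gap of the compressed Weil form on the window `[-a,a]` is
(minus twice) the CROSS-ORIGIN (Hankel) pairing of the two sector ground states through the Weil
kernel, and for `x > 0` that kernel splits as POLE − TRIVIAL ZEROS − PRIMES:
`W(x) = e^{x/2} − e^{-x/2}/(e^{2x} − 1) − Σ_n Λ(n) n^{-1/2} δ(x − log n)`.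
First lemmas typed here (all RH-free; none is proved here, they only have to elaborate).
-/

open scoped ArithmeticFunction.vonMangoldt
open MeasureTheory Set

namespace Summit.RiemannHypothesis.RiemannHypothesis.Cruxes.EvenWinsBeyondArch.HankelChannel

open Literature.NumberTheory.LFunctions

/-- The smooth part of the cross-origin Weil kernel for `x > 0`: pole channel `e^{x/2}` minus the
trivial-zero channel `Σ_{m ≥ 1} e^{-(2m+1/2)x} = e^{-x/2}/(e^{2x} − 1)`
(`= 2 cosh(x/2) − weilArchDensity x`). -/
noncomputable def hankelKernelSmooth (x : ℝ) : ℝ :=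
  Real.exp (x / 2) - Real.exp (-x / 2) / (Real.exp (2 * x) - 1)

/-- The Hankel (reflection) self-pairing of a real half-line profile `f` through the Weil kernel,
written channel by channel: `(Mf 1)² − Σ_{m≥1} (Mf(−2m))² − Σ_n Λ(n) n^{-1/2} (f ∗ f)(log n)`,
`Mf(s) = ∫ f e^{(s−1/2)t}`. -/
noncomputable def hankelPairing (f : ℝ → ℝ) : ℝ :=
  (∫ t : ℝ, f t * Real.exp (t / 2)) ^ 2
    - (∑' m : ℕ, (∫ t : ℝ, f t * Real.exp (-((2 * ((m : ℝ) + 1)) + 1 / 2) * t)) ^ 2)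
    - ∑' n : ℕ, (Λ n : ℝ) / Real.sqrt n * ∫ t : ℝ, f t * f (Real.log n - t)

/-- FIRST LEMMA 1 (RH-free, continuum; provable from `weilMarkovQuadratic_eq_weilDirichletEnergy_sub`,
`weilPoleForm` and Widder's expansion `weilArchDensity x = Σ_{m≥0} e^{-(2m+1/2)x}`):
for a real smooth `f` compactly supported inside `(0, ∞)`, the even and odd reflections
`f(t) ± f(−t)` have Weil energies differing by four times the Hankel pairing. -/
def HankelChannelReflection : Prop :=
  ∀ f : ℝ → ℝ, ContDiff ℝ ((⊤ : ℕ∞) : WithTop ℕ∞) f → HasCompactSupport f →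
    tsupport f ⊆ Ioi (0 : ℝ) →
      (weilQuadratic (fun t ↦ ((f t + f (-t) : ℝ) : ℂ))).re
        - (weilQuadratic (fun t ↦ ((f t - f (-t) : ℝ) : ℂ))).re = 4 * hankelPairing f

/-- FIRST LEMMA 1′ (kernel form of the same pairing): the smooth channels recombine into the
double integral against `hankelKernelSmooth (t + s)`. -/
def HankelPairingKernelForm : Prop :=
  ∀ f : ℝ → ℝ, ContDiff ℝ ((⊤ : ℕ∞) : WithTop ℕ∞) f → HasCompactSupport f →
    tsupport f ⊆ Ioi (0 : ℝ) →
      hankelPairing f + (∑' n : ℕ, (Λ n : ℝ) / Real.sqrt n * ∫ t : ℝ, f t * f (Real.log n - t))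
        = ∫ t : ℝ, ∫ s : ℝ, hankelKernelSmooth (t + s) * f t * f s

/-- FIRST LEMMA 2 (sign structure of the smooth channel): attractive exactly below the
plastic-number scale, `e^{x/2} − e^{-x/2}/(e^{2x}−1) < 0 ↔ e^{3x} < e^{x} + 1` (`x > 0`),
i.e. `x < log ρ_P = 0.28120…`, `ρ_P³ = ρ_P + 1`. -/
def HankelKernelSignThreshold : Prop :=
  ∀ x : ℝ, 0 < x → (hankelKernelSmooth x < 0 ↔ Real.exp (3 * x) < Real.exp x + 1)

/-- FIRST LEMMA 3 (the half-space commutator identity, exact model of (★) — the version verified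
numerically): a real symmetric matrix on a reflection-symmetric index set `ι ⊕ ι` (`inl k ↔ +t_k`,
`inr k ↔ −t_k`) commuting with the reflection; `u` an even eigenvector (`εe`), `w` an odd one (`εo`).
Then `(εo − εe) · Σ_{k} u₊(k) w₊(k) = −2 · Σ_{k,l} u₊(k) H(+t_k, −t_l) w₊(l)`:
parity gap × half-line overlap = −2 × cross-origin (Hankel) pairing. -/
def HalfSpaceCommutatorIdentity : Prop :=
  ∀ (ι : Type) [Fintype ι] (H : Matrix (ι ⊕ ι) (ι ⊕ ι) ℝ), H.IsSymm →
    (∀ i j, H (Sum.swap i) (Sum.swap j) = H i j) →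
    ∀ (u w : ι ⊕ ι → ℝ) (εe εo : ℝ),
      (∀ i, u (Sum.swap i) = u i) → (∀ i, w (Sum.swap i) = -w i) →
      H.mulVec u = εe • u → H.mulVec w = εo • w →
        (εo - εe) * ∑ k, u (Sum.inl k) * w (Sum.inl k)
          = -2 * ∑ k, ∑ l, u (Sum.inl k) * H (Sum.inl k) (Sum.inr l) * w (Sum.inl l)

/-- The crux this idea is filed against (by name; nothing is claimed about it here). -/
example : Prop := Summit.RiemannHypothesis.RiemannHypothesis.Theses.GroundBarta.EvenWinsBeyondArch

end Summit.RiemannHypothesis.RiemannHypothesis.Cruxes.EvenWinsBeyondArch.HankelChannel
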